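import Summits.AtomisticToContinuum.HydrodynamicLimit.Theorems.BoxDissipativeWeakStrongRelativeEnergyStabilityCoercive
import HarnessLib

/-!
# Crux `EntropyAdmissibility` (stmt-AtomisticToContinuum-9903), line `mean_via_weak_strong` —
# stub `stub_boxL1OfVanishes` (C3e)

Registered stub C3e of the line `mean_via_weak_strong` of the crux
`Summit.AtomisticToContinuum.HydrodynamicLimit.Theses.BoxDissipativeWeakStrong.EntropyAdmissibility`:
vanishing of the mean CLAMPED box relative energy at a time `t ∈ [0,T)`
(`RES.BoxClampedRelEnergyVanishesAt … t`) forces box-scale `L¹(P_N ⊗ dx)` convergence of the box fields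
`(ρ̂, m̂, Ê)(t)` to `(ρ, ρu, E)(t)` (`RES.BoxFieldsL1At … t`). This is Step 1 of the landed
`RES.stub_clampedRelEnergyCoercive` (Theorems/…RelativeEnergyStabilityCoercive.lean), extracted verbatim:

1. pointwise coercivity (`RES.co_pointwise_estimate`): `dev(Û | (ρ,u,θ)(t,x)) ≤ ε + K'(ε) ℰ_Z` for every
   admissible box state, frozen boxes admitted only below a density threshold `ρs`;
2. admissibility `P_N`-a.s. at time `t` (`RES.co_ae_distinctVel`; one-particle boxes have density
   `((N+1)ℓ_N³)⁻¹ ≤ ρs` eventually along a kinetic window);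
3. integration in `x` and in `P_N` (`RES.co_pathwise_integral_le`), and the two-parameter limit lemma
   `RES.co_tendsto_zero_of_le`.

References: J. Březina, E. Feireisl, *Measure-valued solutions to the complete Euler system*, J. Math. Soc.
Japan 70 (2018), §3.1–3.2; E. Feireisl, A. Novotný, *Mathematics of Open Fluid Systems* (2022), Ch. 6
(relative energy inequality). prover-line-stmt-AtomisticToContinuum-9903-c3-0.
-/

noncomputable section

open MeasureTheory Filter Set
open scoped ENNReal Topology

namespace Summit.AtomisticToContinuum.HydrodynamicLimit.Theorems.EAMeanWSe

open Literature.MathematicalPhysics.KineticTheory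
open Summit.AtomisticToContinuum.HydrodynamicLimit.Theses
open Summit.AtomisticToContinuum.HydrodynamicLimit.Theorems.RES
open Literature.Analysis.FluidPDE Literature.Analysis.FunctionSpaces
open Literature.Analysis.FluidPDE.CompressibleEuler
open Literature.Analysis.FluidPDE.CompressibleEuler.EulerPhase
open Literature.Analysis.FluidPDE.CompressibleEuler.StrongPointData


/-- **C3e — clamped vanishing ⇒ box-scale `L¹(P_N ⊗ dx)` convergence (size S–M; Step 1 of
`RES.stub_clampedRelEnergyCoercive`, extracted).** Verbatim the statement of `RES.stub_clampedRelEnergyCoercive` with the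
conclusion `TendstoHydroFieldsAt … t` replaced by `RES.BoxFieldsL1At σ a₀ u₀ θ₀ Φ ρ u θ ℓ t`; proof = its Step 1 (`hDlim`:
`co_pointwise_estimate`, `co_ae_distinctVel`, `co_pathwise_integral_le`, `co_tendsto_zero_of_le`). Sources: BrezinaFeireisl2018 §3.1–3.2. -/
def Sig.stub_boxL1OfVanishes : Prop :=
  BoxDissipativeWeakStrong.HsEosLowDensity →
      ∃ ηd : ℝ, 0 < ηd ∧ ∀ η₁ : ℝ, 0 < η₁ → η₁ < ηd →
        ∀ (a₀ θ₀ : T3 → ℝ) (u₀ : T3 → V3), Continuous a₀ → Continuous θ₀ → Continuous u₀ →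
          (∀ x, 0 < a₀ x) → (∀ x, 0 < θ₀ x) →
          ∀ σ : ℝ, 0 < σ → σ ≤ 1 / 2 →
            ∀ (T : ℝ) (ρ θ : ℝ → T3 → ℝ) (u : ℝ → T3 → V3), IsHardSphereEulerSolution σ T ρ u θ →
              ∀ Φ : (N : ℕ) → HardSphereFlow (Literature.Analysis.FluidPDE.Torus.geometry (Fin 3))
                  (hsDiameter σ N) (N + 1),
                ∀ ℓ : ℕ → ℝ, IsKineticWindow ℓ →
                  ∀ t ∈ Ico 0 T, ∀ a b : ℝ, ClampAdmissible σ η₁ a b ρ θ t →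
                    BoxClampedRelEnergyVanishesAt σ η₁ a b a₀ u₀ θ₀ Φ ρ u θ ℓ t →
                      BoxFieldsL1At σ a₀ u₀ θ₀ Φ ρ u θ ℓ t

/-- **C3e — clamped vanishing ⇒ box-scale `L¹(P_N ⊗ dx)` convergence.** Step 1 of
`RES.stub_clampedRelEnergyCoercive`: the pointwise coercivity estimate `dev ≤ ε + K' ℰ_Z` on admissible box
states (`co_pointwise_estimate`), admissibility `P_N`-a.s. (`co_ae_distinctVel`, kinetic window), integration
in `x` (`co_pathwise_integral_le`) and in `P_N` (probability measures `localGibbsLaw`, `σ ≤ 1/2`), and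
`co_tendsto_zero_of_le`. -/
theorem stub_boxL1OfVanishes : Sig.stub_boxL1OfVanishes := by
  -- adapted from `RES.stub_clampedRelEnergyCoercive` (…RelativeEnergyStabilityCoercive.lean), Step 1
  rintro ⟨η₀, hη₀, F, hF, hEq, -, -, -⟩
  obtain ⟨ηd, hηd, hηd₀, hpw⟩ := co_pointwise_estimate hη₀ hF hEq
  refine ⟨ηd, hηd, ?_⟩
  intro η₁ hη₁ hη₁d a₀ θ₀ u₀ ha hθ hu ha0 hθ0 σ hσ hσ2 T ρ θ u hsol Φ ℓ hℓ t ht a b hadm hvan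
  have hη₁₀ : η₁ < η₀ := hη₁d.trans_le hηd₀
  -- the strong data at time `t`
  have hρc : Continuous (ρ t) := (hsol.smooth_density.isSmooth_slice ht).continuous
  have huc : Continuous (u t) := (hsol.smooth_velocity.isSmooth_slice ht).continuous
  have hθc : Continuous (θ t) := (hsol.smooth_temperature.isSmooth_slice ht).continuous
  have hρt0 : ∀ x, 0 < ρ t x := hsol.density_pos t ht
  have hθt0 : ∀ x, 0 < θ t x := hsol.temperature_pos t ht
  have hμC : Continuous fun x => (cutEOS σ η₁).chemPotential (ρ t x) (θ t x) :=
    (cc_continuousOn_chemPotential hF hEq hη₁ hη₁₀ hσ).comp_continuous (hρc.prodMk hθc)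
      fun x => ⟨hρt0 x, hθt0 x⟩
  have hpC : Continuous fun x => (cutEOS σ η₁).p (ρ t x) (θ t x) :=
    tz_continuous_p hF hEq hη₁ hη₁₀ hσ hρc hθc hρt0
  haveI hprob : ∀ N, IsProbabilityMeasure (localGibbsLaw σ a₀ u₀ θ₀ N (Φ N)) := fun N =>
    isProbabilityMeasure_localGibbsLaw ha hθ hu ha0 hθ0 hσ2 N (Φ N)
  -- the pointwise estimate at time `t`
  obtain ⟨ρs, hρs, hK'⟩ := hpw η₁ hη₁ hη₁d σ hσ T ρ θ u hsol t ht a b hadm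
  -- one-particle boxes are below the density threshold eventually (kinetic window)
  have hev : ∀ᶠ N : ℕ in atTop, ((N : ℝ) + 1)⁻¹ * (ℓ N ^ 3)⁻¹ ≤ ρs := by
    filter_upwards [hℓ.2.2.eventually_ge_atTop ρs⁻¹] with N hN
    have hpos : 0 < ℓ N ^ 3 * ((N : ℝ) + 1) := mul_pos (pow_pos (hℓ.1 N).1 3) (by positivity)
    rw [← mul_inv_rev, inv_le_comm₀ hpos hρs]
    exact hN
  -- the mean box deviation vanishes
  unfold BoxFieldsL1At
  refine co_tendsto_zero_of_le hvan fun ε hε => ?_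
  obtain ⟨K', hK'0, hpt⟩ := hK' ε hε
  refine ⟨ENNReal.ofReal K', ENNReal.ofReal_ne_top, ?_⟩
  filter_upwards [hev] with N hN
  calc ∫⁻ z, ENNReal.ofReal (∫ x,
        (|empiricalDensityField ((Φ N).flow t z) (boxKernel (ℓ N) x) - ρ t x| +
          ‖empiricalMomentumField ((Φ N).flow t z) (boxKernel (ℓ N) x) - ρ t x • u t x‖ +
          |empiricalEnergyField ((Φ N).flow t z) (boxKernel (ℓ N) x) -
            totalEnergyDensity (ρ t x) (u t x) (θ t x)|)) ∂(localGibbsLaw σ a₀ u₀ θ₀ N (Φ N))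
      ≤ ∫⁻ z, (ENNReal.ofReal ε + ENNReal.ofReal K' *
          ENNReal.ofReal (clampedRelEnergyObs σ η₁ a b ρ u θ N (Φ N) (ℓ N) t z))
          ∂(localGibbsLaw σ a₀ u₀ θ₀ N (Φ N)) := by
        refine lintegral_mono_ae ((co_ae_distinctVel N (Φ N) t).mono fun z hz => ?_)
        have hpath := co_pathwise_integral_le (a := a) (b := b)
          (hℓ.1 N).1 hρc huc hθc hμC hpC hpt ((Φ N).flow t z) hz hN
        calc ENNReal.ofReal _
            ≤ ENNReal.ofReal (ε + K' * clampedRelEnergyObs σ η₁ a b ρ u θ N (Φ N) (ℓ N) t z) :=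
              ENNReal.ofReal_le_ofReal hpath
          _ ≤ ENNReal.ofReal ε +
                ENNReal.ofReal (K' * clampedRelEnergyObs σ η₁ a b ρ u θ N (Φ N) (ℓ N) t z) :=
              ENNReal.ofReal_add_le
          _ = _ := by rw [ENNReal.ofReal_mul hK'0]
    _ = ENNReal.ofReal ε + ENNReal.ofReal K' *
          ∫⁻ z, ENNReal.ofReal (clampedRelEnergyObs σ η₁ a b ρ u θ N (Φ N) (ℓ N) t z)
            ∂(localGibbsLaw σ a₀ u₀ θ₀ N (Φ N)) := by
        rw [lintegral_add_left measurable_const, lintegral_const, measure_univ, mul_one,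
          lintegral_const_mul' _ _ ENNReal.ofReal_ne_top]

end Summit.AtomisticToContinuum.HydrodynamicLimit.Theorems.EAMeanWSe

end
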